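import Summits.Ventures.LatticeQCDFlow.Scaling.SectorOfferCeiling

/-!
HONEST FRAMING: exact (Metropolis-corrected) sampling algorithms for lattice gauge theory; figures
of merit are autocorrelation/cost numbers at stated couplings and volumes; no continuum-physics
claim.

# TightSectorAutocorrelationFloor — THE SLOWEST OBSERVABLE HAS `τ_int = 1/Gap − ½` EXACTLY (ITS SECOND EIGENFUNCTION), SO AT A TIGHT SECTOR SOME
# OBSERVABLE OF THE MAP-ASSISTED HUB HAS `τ_int ≥ m/(t·c_k·p') − ½` AND `τ_int ≥ (1−θ)K/(p'·min{t,(1−t)w_0}) − ½`: WITH CHAPTER N'S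
# `τ_int ≤ 1/(p·min{ct/(3m),(1−t)w_0/(7K)}) − ½` THE AUTOCORRELATION TIME IS LINEAR IN `1/p` FROM BOTH SIDES (lean-2 GEN-29, ours)

Venture-side (OURS).  Cell `lqcd-flow` (pub-lqcd), unit `pub-lqcd-lean-2-g29`, 2026-08-28.  Chapter O (the floor sees the map quality), file 9.
`τ_int(g) = v(g)/(2Var_π̃ g)` with Kemeny–Snell's asymptotic variance `v` (the tree's `asympVar`, as in `Scaling/DominatedStarRegimeFreeAutocorrelation`).
For a centred eigenfunction `Pg = λg` (`λ ≠ 1`) of an irreducible chain the fundamental matrix gives `Zg = g/(1−λ)`, hence `v(g) = ((1+λ)/(1−λ))‖g‖²_π`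
and `τ_int(g) = (1+λ)/(2(1−λ))`; at `λ = λ₂ = 1 − Gap` this is `1/Gap − ½`, so every gap CEILING is an autocorrelation FLOOR for the second
eigenfunction.  Applied to `Scaling/SectorOfferCeiling` (O3: `Gap ≤ t·c_k·p'/m`) and `Scaling/TightSectorGapLaw` (O1).

## What is proved

* **`asympVar_eigenfunction`** — `Σπg = 0`, `Pg = λg`, `λ ≠ 1`, `P` irreducible row-stochastic with stationary probability `π`:
  `v(g) = ((1+λ)/(1−λ))·‖g‖²_π`; **`tauInt_secondEigenfunction`** — reversible, `|X| ≥ 2`: some `g` with `Var_π g = 1` has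
  `v(g)/(2Var_π g) = 1/Gap − ½`.
* **`tightSector_tauInt_ge_level`** — tight sector, sector-idle cold level `k+1` listed `c_k` times, any hot kernel making the scheme irreducible:
  **some observable has `τ_int ≥ m/(t·c_k·p') − ½`**; **`tightSector_tauInt_two_sided`** — exact hot redraws, one-sided domination, multiplicities `≥ c`:
  `m/(t·c_k·p') − ½ ≤ τ_int(g)` for that `g`, while `τ_int(g') ≤ 1/(p·min{ct/(3m),(1−t)w_0/(7K)}) − ½` for EVERY `g'` (N3).

Reading (no numerics implied): OPEN-MATH item 5 asked whether `τ_int = Θ(m/(cp))` is achievable at a `p`-independent swap fraction; N3 achieved it and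
this file shows it cannot be beaten in `p`: at a quality-`p'` tight sector the sector indicator's slow mode has `τ_int ≥ m/(t·c_k·p') − ½`.  NOT
CLAIMED: which observable is slow on a lattice instance; anything measured.  Literature grade (cell rule): OWN COROLLARY (Kemeny–Snell `Z` on an
eigenfunction + O1/O3 + N3); nothing cited as a fact; no new bib keys.
-/

noncomputable section

open Finset Function Matrix
open Literature.Probability.MarkovChains

namespace Summit.Ventures.LatticeQCDFlow.Scaling

/-! ## §1 The asymptotic variance of an eigenfunction -/

section Generic
variable {X : Type*} [Fintype X] [DecidableEq X]

/-- **`v(g) = ((1+λ)/(1−λ))·‖g‖²_π` for a centred eigenfunction** (`Σπg = 0`, `Pg = λg`, `λ ≠ 1`; `P` row-stochastic, irreducible, `π` a stationary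
probability vector): `Zg = g/(1−λ)` for Kemeny–Snell's fundamental matrix. [ours] -/
theorem asympVar_eigenfunction {P : Matrix X X ℝ} (hP : IsRowStochastic P) {π : X → ℝ} (hπ1 : ∑ x, π x = 1)
    (hst : IsStationary π P) (hirr : Literature.Probability.MarkovChains.IsIrreducible P) {g : X → ℝ} (hg0 : ∑ x, π x * g x = 0) {lam : ℝ}
    (hPg : P *ᵥ g = lam • g) (hlam : lam ≠ 1) :
    asympVar g π P = (1 + lam) / (1 - lam) * piInner π g g := by
  have hK := isUnit_fundamentalInv hπ1 hP hst hirr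
  have h1l : 1 - lam ≠ 0 := sub_ne_zero.mpr (Ne.symm hlam)
  -- `(I − (P − A)) g = (1 − λ) g`
  have hAg : limitMatrix π *ᵥ g = 0 := by
    funext x
    simp [limitMatrix, mulVec, dotProduct, hg0]
  have hIg : (1 - (P - limitMatrix π)) *ᵥ g = (1 - lam) • g := by
    rw [sub_mulVec, one_mulVec, sub_mulVec, hPg, hAg, sub_zero]
    funext x
    simp only [Pi.sub_apply, Pi.smul_apply, smul_eq_mul]
    ring
  -- hence `Z g = g/(1−λ)`
  have hZg : fundamentalMatrix π P *ᵥ g = (1 / (1 - lam)) • g := by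
    have h := congrArg (fun v => fundamentalMatrix π P *ᵥ v) hIg
    rw [mulVec_mulVec, fundamentalMatrix_mul_fundamentalInv hK, one_mulVec, mulVec_smul] at h
    -- `g = (1−λ) • Z g`
    have h2 : (1 / (1 - lam)) • g = (1 / (1 - lam)) • ((1 - lam) • (fundamentalMatrix π P *ᵥ g)) := by rw [← h]
    rw [h2, smul_smul, one_div, inv_mul_cancel₀ h1l, one_smul]
  rw [asympVar_eq_sums, hZg, hg0]
  unfold piInner
  simp only [Pi.smul_apply, smul_eq_mul]
  rw [show ∑ x, π x * (g x * (1 / (1 - lam) * g x)) = 1 / (1 - lam) * ∑ x, π x * (g x * g x) by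
    rw [mul_sum]; exact sum_congr rfl fun x _ => by ring]
  field_simp
  ring

/-- **THE SECOND EIGENFUNCTION HAS `τ_int = 1/Gap − ½`:** for a reversible irreducible chain on `|X| ≥ 2` points with positive stationary `π` there is
an observable `g` with `Var_π g = 1` and `v(g)/(2·Var_π g) = 1/Gap − ½`. [ours] -/
theorem tauInt_secondEigenfunction [Nontrivial X] {P : Matrix X X ℝ} (hP : IsRowStochastic P) {π : X → ℝ} (hπ : ∀ x, 0 < π x)
    (hπ1 : ∑ x, π x = 1) (hDB : DetailedBalance π P) (hirr : Literature.Probability.MarkovChains.IsIrreducible P) :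
    ∃ g : X → ℝ, lawVariance π g = 1 ∧ asympVar g π P / (2 * lawVariance π g) = 1 / spectralGap π P - 1 / 2 := by
  have hst : IsStationary π P := hDB.isStationary hP.2
  obtain ⟨g, hg0, hg1, -, hPg⟩ := exists_eigenfunction_spectralGap hπ hπ1 hP hDB
  have hgap : 0 < spectralGap π P := spectralGap_pos hπ hπ1 hP hDB hirr
  have hlam : secondEigenvalue π P = 1 - spectralGap π P := by unfold spectralGap; ring
  have hvar : lawVariance π g = 1 := by
    have hmean : lawMean π g = 0 := hg0
    rw [← piInner_centred_eq_lawVariance, hmean]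
    simp only [sub_zero]
    exact hg1
  refine ⟨g, hvar, ?_⟩
  have hv := asympVar_eigenfunction hP hπ1 hst hirr hg0 hPg (by rw [hlam]; linarith)
  have hg0' : spectralGap π P ≠ 0 := hgap.ne'
  rw [hv, hg1, hvar, hlam, show (1 : ℝ) - (1 - spectralGap π P) = spectralGap π P by ring]
  field_simp
  ring

end Generic

/-! ## §2 The autocorrelation floor of the map-assisted hub at a tight sector -/

variable {S : Type*} [Fintype S] [DecidableEq S] {K m : ℕ} {μ : Fin (K + 1) → S → ℝ} {M : Fin (K + 1) → S → S → ℝ}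
  {w : Fin (K + 1) → ℝ} {t p : ℝ}

section Star
variable (κ : Fin m → Fin K) (φ : Fin m → Equiv.Perm S)

/-- **SOME OBSERVABLE HAS `τ_int ≥ m/(t·c_k·p') − ½`** at a tight sector (`μ_j(A) = θ ∈ (0,1)` for `j ≠ 0`, `μ_0(A) ≤ p'θ`, level `k+1` sector-idle,
`A`-preserving maps, `μ_j`-reversible kernels, `0 < t ≤ 1`, `c_k ≥ 1` entries at level `k`, the scheme irreducible, `|S| ≥ 2`). [ours] -/
theorem tightSector_tauInt_ge_level [Nontrivial S] (hm : 1 ≤ m) (hμ : ∀ k x, 0 < μ k x) (hμ1 : ∀ k, ∑ u, μ k u = 1)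
    (hM : ∀ k, IsRowStochastic (M k)) (hMrev : ∀ k, DetailedBalance (μ k) (M k)) (hw0 : ∀ k, 0 ≤ w k) (hw1 : ∑ k, w k = 1)
    (ht0 : 0 < t) (ht1 : t ≤ 1) {A : Finset S} (hφA : ∀ r u, φ r u ∈ A ↔ u ∈ A) {θ p' : ℝ} (hθ0 : 0 < θ) (hθ1 : θ < 1)
    (hcold : ∀ j : Fin (K + 1), j ≠ 0 → ∑ u ∈ A, μ j u = θ) (hhot : ∑ u ∈ A, μ 0 u ≤ p' * θ) (k : Fin K)
    (hck : 1 ≤ (univ.filter (fun r : Fin m => κ r = k)).card) (hidle : w k.succ * edgeMeasure (μ k.succ) (M k.succ) A Aᶜ = 0)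
    (hirr : Literature.Probability.MarkovChains.IsIrreducible (fun y z : Fin (K + 1) → S =>
        t * ptGraphSwap μ (fun r : Fin m => (((0 : Fin (K + 1)), (κ r).succ) : Fin (K + 1) × Fin (K + 1))) φ y z
          + (1 - t) * prodKernel w M y z)) :
    ∃ g : (Fin (K + 1) → S) → ℝ, lawVariance (tensorFun μ) g = 1 ∧
      m / (t * ((univ.filter (fun r : Fin m => κ r = k)).card : ℝ) * p') - 1 / 2
        ≤ asympVar g (tensorFun μ) (fun y z : Fin (K + 1) → S =>
            t * ptGraphSwap μ (fun r : Fin m => (((0 : Fin (K + 1)), (κ r).succ) : Fin (K + 1) × Fin (K + 1))) φ y z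
              + (1 - t) * prodKernel w M y z) / (2 * lawVariance (tensorFun μ) g) := by
  have hmpos : (0 : ℝ) < m := Nat.cast_pos.mpr (by omega)
  have hckpos : (0 : ℝ) < ((univ.filter (fun r : Fin m => κ r = k)).card : ℝ) := Nat.cast_pos.mpr (by omega)
  set e : Fin m → Fin (K + 1) × Fin (K + 1) := fun r => (((0 : Fin (K + 1)), (κ r).succ) : Fin (K + 1) × Fin (K + 1))
    with he_def
  have hP := weightedScheme_isRowStochastic (t := t) (w := w) (ptGraphSwap_isRowStochastic (e := e) (φ := φ) hμ) hM hw0 hw1 ht0.le ht1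
  have hDB := weightedScheme_detailedBalance (w := w) (ptGraphSwap_detailedBalance (e := e) (φ := φ) hμ) hMrev t
  obtain ⟨g, hvar, htau⟩ := tauInt_secondEigenfunction hP (tensorFun_pos hμ) (sum_tensorFun_eq_one μ hμ1) hDB hirr
  refine ⟨g, hvar, ?_⟩
  rw [htau]
  have hgap := tightSector_spectralGap_le_level κ φ hm hμ hμ1 hM hMrev hw0 hw1 ht0.le ht1 hφA hθ0 hθ1 hcold hhot k hidle
  have hgpos : 0 < spectralGap (tensorFun μ) (fun y z : Fin (K + 1) → S => t * ptGraphSwap μ e φ y z + (1 - t) * prodKernel w M y z) :=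
    spectralGap_pos (tensorFun_pos hμ) (sum_tensorFun_eq_one μ hμ1) hP hDB hirr
  have hpp : 0 < t * ((univ.filter (fun r : Fin m => κ r = k)).card : ℝ) * p' := by
    have h := lt_of_lt_of_le hgpos hgap
    have : 0 < t * ((univ.filter (fun r : Fin m => κ r = k)).card : ℝ) * p' / m := h
    exact (div_pos_iff_of_pos_right hmpos).mp this
  have hinv : m / (t * ((univ.filter (fun r : Fin m => κ r = k)).card : ℝ) * p')
      ≤ 1 / spectralGap (tensorFun μ) (fun y z : Fin (K + 1) → S => t * ptGraphSwap μ e φ y z + (1 - t) * prodKernel w M y z) := by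
    rw [div_le_div_iff₀ hpp hgpos, one_mul]
    have := (le_div_iff₀ hmpos).mp hgap
    linarith
  linarith

/-- **THE AUTOCORRELATION TIME IS LINEAR IN `1/p` FROM BOTH SIDES:** exact hot redraws, one-sided domination `p ∈ (0,1]`, multiplicities `≥ c ≥ 1`,
`0 < t < 1`, `w_0 > 0`, tight sector, level `k+1` sector-idle: some `g` with `Var_π̃ g = 1` has **`m/(t·c_k·p') − ½ ≤ τ_int(g)`**, and **every** `g'` of
positive variance has `τ_int(g') ≤ 1/(p·min{ct/(3m), (1−t)w_0/(7K)}) − ½` (`Scaling/DominatedStarRegimeFreeAutocorrelation`). [ours] -/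
theorem tightSector_tauInt_two_sided [Nontrivial S] (hK : 1 ≤ K) (hm : 1 ≤ m) (ht0 : 0 < t) (ht1 : t < 1)
    (hw0 : ∀ k, 0 ≤ w k) (hw00 : 0 < w 0) (hw1 : ∑ k, w k = 1) (hμ : ∀ k x, 0 < μ k x)
    (hμ1 : ∀ k, ∑ u, μ k u = 1) (hM : ∀ k, IsRowStochastic (M k)) (hMrev : ∀ k, DetailedBalance (μ k) (M k))
    (hM0 : ∀ u v, M 0 u v = μ 0 v) (hp0 : 0 < p) (hp1 : p ≤ 1) (hdom : ∀ r u, p * μ (κ r).succ (φ r u) ≤ μ 0 u)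
    {c : ℕ} (hc1 : 1 ≤ c) (hc : ∀ p' : Fin K, c ≤ (univ.filter (fun r : Fin m => κ r = p')).card)
    {A : Finset S} (hφA : ∀ r u, φ r u ∈ A ↔ u ∈ A) {θ p' : ℝ} (hθ0 : 0 < θ) (hθ1 : θ < 1)
    (hcold : ∀ j : Fin (K + 1), j ≠ 0 → ∑ u ∈ A, μ j u = θ) (hhot : ∑ u ∈ A, μ 0 u ≤ p' * θ) (k : Fin K)
    (hidle : w k.succ * edgeMeasure (μ k.succ) (M k.succ) A Aᶜ = 0) :
    (∃ g : (Fin (K + 1) → S) → ℝ, lawVariance (tensorFun μ) g = 1 ∧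
      m / (t * ((univ.filter (fun r : Fin m => κ r = k)).card : ℝ) * p') - 1 / 2
        ≤ asympVar g (tensorFun μ) (fun y z : Fin (K + 1) → S =>
            t * ptGraphSwap μ (fun r : Fin m => (((0 : Fin (K + 1)), (κ r).succ) : Fin (K + 1) × Fin (K + 1))) φ y z
              + (1 - t) * prodKernel w M y z) / (2 * lawVariance (tensorFun μ) g))
    ∧ ∀ g' : (Fin (K + 1) → S) → ℝ, 0 < lawVariance (tensorFun μ) g' →
        asympVar g' (tensorFun μ) (fun y z : Fin (K + 1) → S =>
            t * ptGraphSwap μ (fun r : Fin m => (((0 : Fin (K + 1)), (κ r).succ) : Fin (K + 1) × Fin (K + 1))) φ y z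
              + (1 - t) * prodKernel w M y z) / (2 * lawVariance (tensorFun μ) g')
          ≤ 1 / (p * min (c * t / (3 * m)) ((1 - t) * w 0 / (7 * K))) - 1 / 2 := by
  have hirr := dominatedStar_isIrreducible_regimeFree κ φ ht0 ht1 hw0 hw00 hw1 hμ hM hM0 hc1 hc
  refine ⟨tightSector_tauInt_ge_level κ φ hm hμ hμ1 hM hMrev hw0 hw1 ht0 ht1.le hφA hθ0 hθ1 hcold hhot k (hc1.trans (hc k)) hidle hirr,
    fun g' hg' => ?_⟩
  exact dominatedStar_tauInt_le_regimeFree κ φ hK hm ht0 ht1 hw0 hw00 hw1 hμ hμ1 hM hMrev hM0 hp0 hp1 hdom hc1 hc hg'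

end Star

end Summit.Ventures.LatticeQCDFlow.Scaling

end
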